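import Mathlib
import Summits.NavierStokesRegularity.NavierStokesRegularity.Theorems.FilamentSkeletonRssDefectColumnGateAzimuthalBlockTools

/-!
# Route `FilamentSkeletonRss` · crux `TransverseReduction1AG` (stmt-NavierStokesRegularity-27853; A1L twin stmt-23297) · line
# `defect_column_gate_1AG/1AL` — PRELIMINARIES for the Gaussian-class fast-rotation sup bound of the azimuthal blocks of S2a-loc
# `WaistColumnGateLoc1A`: a pointwise weight comparison, a pointwise AM–GM for forcing pairings, the three pieces of real ALGEBRA that
# close the core estimate, and the extraction of the sup from the two dissipation currencies on the whole core

Helper file (`--supports stmt-NavierStokesRegularity-27853 --as helper`; seat ns-filament-s2aloc-p1 g2; note ARCHITECTURE-B2B3-s2aloc-g2.md v2 §6).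
The algebra lemmas are stated for bare real numbers (the "currencies" `𝒞 = ∫EΩs`, `IE = ∫Es`, `D + D₂`, `I₄ = ∫E/(1+u)⁴`, …) so that the assembly
in `…AzimuthalBlockCoreGauss.lean` is a short chain; `core_extraction_le` turns the currencies `D = ∫₀^U E·4u(a′²+b′²)`,
`D₂ = ∫₀^U E·m²(a²+b²)/u` into the pointwise bound `a² + b² ≤ 3D₂/m² + D/4` on `(0, U]` via `sq_le_extraction_of_mem` on dyadic intervals.
HONEST FRAMING: elementary lemmas serving ONE family of blocks of ONE linear MODEL operator of a hypothetical blow-up route (MODEL rung, negative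
side); nothing here bears on NS regularity.
-/

set_option linter.dupNamespace false

noncomputable section

namespace Summit.NavierStokesRegularity.NavierStokesRegularity.Theorems.DefectColumnGate

open scoped Topology
open Set Filter MeasureTheory intervalIntegral

/-! ## 1. Pointwise lemmas -/

/-- `E ≤ 2π(u + 4/γ)·EΩ`: `e^{γu/4}·X ≤ 2π(u + 4/γ)·[e^{γu/4}(1 − e^{−γu/4})/(2πu)]·X` for `u > 0`, `X ≥ 0` (from `γu/4 ≤ e^{γu/4} − 1`). -/
theorem exp_le_rot_weight {γ u X : ℝ} (hγ : 0 < γ) (hu : 0 < u) (hX : 0 ≤ X) :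
    Real.exp (γ * u / 4) * X
      ≤ 2 * Real.pi * (u + 4 / γ) * (Real.exp (γ * u / 4) * ((1 - Real.exp (-(γ * u / 4))) / (2 * Real.pi * u)) * X) := by
  have hπ : 0 < Real.pi := Real.pi_pos
  have hE : Real.exp (γ * u / 4) * ((1 - Real.exp (-(γ * u / 4))) / (2 * Real.pi * u))
      = (Real.exp (γ * u / 4) - 1) / (2 * Real.pi * u) := by
    have : Real.exp (γ * u / 4) * Real.exp (-(γ * u / 4)) = 1 := by rw [← Real.exp_add]; simp
    rw [mul_div_assoc', mul_sub, mul_one, this]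
  rw [hE]
  have h1 : γ * u / 4 + 1 ≤ Real.exp (γ * u / 4) := Real.add_one_le_exp _
  have h4 : u ≤ 4 / γ * (Real.exp (γ * u / 4) - 1) := by
    have h5 := mul_le_mul_of_nonneg_left (show γ * u / 4 ≤ Real.exp (γ * u / 4) - 1 by linarith)
      (show (0:ℝ) ≤ 4 / γ by positivity)
    have e : 4 / γ * (γ * u / 4) = u := by field_simp
    linarith
  have h2 : Real.exp (γ * u / 4) ≤ 2 * Real.pi * (u + 4 / γ) * ((Real.exp (γ * u / 4) - 1) / (2 * Real.pi * u)) := by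
    rw [show 2 * Real.pi * (u + 4 / γ) * ((Real.exp (γ * u / 4) - 1) / (2 * Real.pi * u))
        = (u + 4 / γ) * (Real.exp (γ * u / 4) - 1) / u by field_simp]
    rw [le_div_iff₀ hu]
    have hE1 : 0 ≤ Real.exp (γ * u / 4) - 1 := by linarith [h1, show 0 ≤ γ * u / 4 by positivity]
    nlinarith [mul_nonneg hu.le hE1]
  calc Real.exp (γ * u / 4) * X ≤ (2 * Real.pi * (u + 4 / γ) * ((Real.exp (γ * u / 4) - 1) / (2 * Real.pi * u))) * X :=
        mul_le_mul_of_nonneg_right h2 hX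
    _ = _ := by ring

/-- Pointwise AM–GM for forcing pairings: `|g₁|, |g₂| ≤ X`, `η > 0` ⇒ `a g₁ + b g₂ ≤ (η/2)(a²+b²) + X²/η` and
`a g₂ − b g₁ ≤ (η/2)(a²+b²) + X²/η`. -/
theorem pairing_amgm {a b g₁ g₂ X η : ℝ} (hη : 0 < η) (hg₁ : |g₁| ≤ X) (hg₂ : |g₂| ≤ X) :
    a * g₁ + b * g₂ ≤ η / 2 * (a ^ 2 + b ^ 2) + X ^ 2 / η ∧ a * g₂ - b * g₁ ≤ η / 2 * (a ^ 2 + b ^ 2) + X ^ 2 / η := by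
  have hX : 0 ≤ X := le_trans (abs_nonneg _) hg₁
  have hg₁sq : g₁ ^ 2 ≤ X ^ 2 := by
    have := pow_le_pow_left₀ (abs_nonneg _) hg₁ 2; rwa [sq_abs] at this
  have hg₂sq : g₂ ^ 2 ≤ X ^ 2 := by
    have := pow_le_pow_left₀ (abs_nonneg _) hg₂ 2; rwa [sq_abs] at this
  have key : ∀ p q : ℝ, q ^ 2 ≤ X ^ 2 → p * q ≤ η / 2 * p ^ 2 + X ^ 2 / (2 * η) := by
    intro p q hq
    have e : η / 2 * p ^ 2 + q ^ 2 / (2 * η) - p * q = (η * p - q) ^ 2 / (2 * η) := by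
      field_simp; ring
    have h0 : 0 ≤ (η * p - q) ^ 2 / (2 * η) := by positivity
    have h1 : q ^ 2 / (2 * η) ≤ X ^ 2 / (2 * η) := div_le_div_of_nonneg_right hq (by positivity)
    linarith
  have e2 : X ^ 2 / η = X ^ 2 / (2 * η) + X ^ 2 / (2 * η) := by field_simp; ring
  constructor
  · have h1 := key a g₁ hg₁sq
    have h2 := key b g₂ hg₂sq
    linarith
  · have h1 := key a g₂ hg₂sq
    have h2 := key b (-g₁) (by rw [neg_sq]; exact hg₁sq)
    linarith

/-! ## 2. The real algebra of the core estimate -/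

/-- (Im)-algebra: from `c₁Rc·𝒞 + mρ·IE ≤ I_rot`, `IE ≤ K𝒞`, `I_rot ≤ (η/2)IE + (X/η)` with `η = c₁Rc/K`, and `m|ρ|K ≤ c₁Rc/4`:
`𝒞 ≤ 4K·X/(c₁²Rc²)`. -/
theorem gauss_currency_bound {𝒞 IE Irot X K c₁ Rc m ρ : ℝ} (hK : 0 < K) (hc₁ : 0 < c₁) (hRc : 0 < Rc) (hm : 0 < m)
    (h𝒞 : 0 ≤ 𝒞) (hIE : 0 ≤ IE)
    (hP : IE ≤ K * 𝒞) (hIm : c₁ * Rc * 𝒞 + m * ρ * IE ≤ Irot)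
    (hrot : Irot ≤ (c₁ * Rc / K) / 2 * IE + X / (c₁ * Rc / K))
    (hρ : m * |ρ| * K ≤ c₁ * Rc / 4) :
    𝒞 ≤ 4 * K * X / (c₁ ^ 2 * Rc ^ 2) := by
  have h1 : (c₁ * Rc / K) / 2 * IE ≤ c₁ * Rc / 2 * 𝒞 := by
    have := mul_le_mul_of_nonneg_left hP (show 0 ≤ (c₁ * Rc / K) / 2 by positivity)
    have e : (c₁ * Rc / K) / 2 * (K * 𝒞) = c₁ * Rc / 2 * 𝒞 := by field_simp
    linarith
  have h2 : X / (c₁ * Rc / K) = K * X / (c₁ * Rc) := by field_simp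
  have h3 : -(c₁ * Rc / 4 * 𝒞) ≤ m * ρ * IE := by
    have h4 : -(m * |ρ| * IE) ≤ m * ρ * IE := by
      have := neg_abs_le ρ
      have h5 : 0 ≤ m * IE := by positivity
      nlinarith
    have h6 : m * |ρ| * IE ≤ m * |ρ| * (K * 𝒞) := mul_le_mul_of_nonneg_left hP (by positivity)
    have h7 : m * |ρ| * (K * 𝒞) ≤ c₁ * Rc / 4 * 𝒞 := by
      have := mul_le_mul_of_nonneg_right hρ h𝒞
      linarith [mul_assoc (m * |ρ|) K 𝒞]
    linarith
  have h8 : c₁ * Rc / 4 * 𝒞 ≤ K * X / (c₁ * Rc) := by linarith [hIm, hrot, h1, h2, h3]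
  rw [le_div_iff₀ (by positivity)]
  have h9 := (le_div_iff₀ (by positivity : 0 < c₁ * Rc)).mp h8
  nlinarith [h9, hc₁, hRc]

/-- (Re)-algebra: from `D + D₂ ≤ γ·IE + I_g + (16/(5m))Rc·𝒞`, `IE ≤ K𝒞`, `I_g ≤ Rc·IE + X/(2Rc)`, `𝒞 ≤ 4KX/(c₁²Rc²)`, `Rc ≥ 1`,
`m ≥ 2`: `D + D₂ ≤ (X/Rc)·(4K((γ+1)K + 4)/c₁² + 1/2)`. -/
theorem gauss_dissipation_bound {DD 𝒞 IE Ig X K c₁ Rc γ m : ℝ} (hK : 0 < K) (hc₁ : 0 < c₁) (hRc : 1 ≤ Rc) (hγ : 0 < γ)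
    (hm : 2 ≤ m) (h𝒞0 : 0 ≤ 𝒞)
    (hRe : DD ≤ γ * IE + Ig + 16 / (5 * m) * Rc * 𝒞) (hP : IE ≤ K * 𝒞)
    (hIg : Ig ≤ (2 * Rc) / 2 * IE + X / (2 * Rc)) (h𝒞 : 𝒞 ≤ 4 * K * X / (c₁ ^ 2 * Rc ^ 2)) :
    DD ≤ X / Rc * (4 * K * ((γ + 1) * K + 4) / c₁ ^ 2 + 1 / 2) := by
  have hRc0 : 0 < Rc := by linarith
  have hm0 : 0 < m := by linarith
  have h165 : 16 / (5 * m) * Rc * 𝒞 ≤ 4 * Rc * 𝒞 := by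
    have : 16 / (5 * m) ≤ 4 := by rw [div_le_iff₀ (by positivity)]; nlinarith
    have := mul_le_mul_of_nonneg_right this (show 0 ≤ Rc * 𝒞 by positivity)
    linarith [mul_assoc (16 / (5 * m)) Rc 𝒞, mul_assoc (4:ℝ) Rc 𝒞]
  have h1 : DD ≤ (γ + Rc) * K * 𝒞 + X / (2 * Rc) + 4 * Rc * 𝒞 := by
    have hγIE : γ * IE ≤ γ * (K * 𝒞) := mul_le_mul_of_nonneg_left hP hγ.le
    have hRcIE : (2 * Rc) / 2 * IE ≤ Rc * (K * 𝒞) := by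
      have := mul_le_mul_of_nonneg_left hP hRc0.le; linarith
    linarith [hRe, hIg]
  have h2 : (γ + Rc) * K * 𝒞 + 4 * Rc * 𝒞 ≤ Rc * ((γ + 1) * K + 4) * 𝒞 := by
    have h21 : 0 ≤ γ * K * (Rc - 1) := mul_nonneg (mul_nonneg hγ.le hK.le) (by linarith)
    have h22 : (γ + Rc) * K + 4 * Rc ≤ Rc * ((γ + 1) * K + 4) := by linarith
    have := mul_le_mul_of_nonneg_right h22 h𝒞0
    linarith
  have h3 : Rc * ((γ + 1) * K + 4) * 𝒞 ≤ Rc * ((γ + 1) * K + 4) * (4 * K * X / (c₁ ^ 2 * Rc ^ 2)) :=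
    mul_le_mul_of_nonneg_left h𝒞 (by positivity)
  have e : Rc * ((γ + 1) * K + 4) * (4 * K * X / (c₁ ^ 2 * Rc ^ 2)) + X / (2 * Rc)
      = X / Rc * (4 * K * ((γ + 1) * K + 4) / c₁ ^ 2 + 1 / 2) := by
    field_simp
  linarith [h1, h2, h3, e]

/-- Final algebra: with `X = M²·I₄`, `I₄ ≤ U·EU`, `c₁ ≥ m/5 > 0`: `(X/Rc)(4K((γ+1)K+4)/c₁² + 1/2) ≤ (U·EU/Rc)(100K((γ+1)K+4)/m² + 1)·M²`. -/
theorem gauss_final_bound {I₄ U EU K c₁ Rc γ m M : ℝ} (hK : 0 < K) (hc₁ : 0 < c₁) (hRc : 0 < Rc) (hγ : 0 < γ) (hm : 0 < m)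
    (hc₁m : m / 5 ≤ c₁) (hI₄0 : 0 ≤ I₄) (hI₄ : I₄ ≤ U * EU) :
    M ^ 2 * I₄ / Rc * (4 * K * ((γ + 1) * K + 4) / c₁ ^ 2 + 1 / 2)
      ≤ (U * EU / Rc) * (100 * K * ((γ + 1) * K + 4) / m ^ 2 + 1) * M ^ 2 := by
  have hnum : 0 ≤ K * ((γ + 1) * K + 4) := by positivity
  have hc₁2 : 4 * K * ((γ + 1) * K + 4) / c₁ ^ 2 ≤ 100 * K * ((γ + 1) * K + 4) / m ^ 2 := by
    rw [div_le_div_iff₀ (by positivity) (by positivity)]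
    have : m ^ 2 ≤ 25 * c₁ ^ 2 := by nlinarith [hc₁m, hm]
    nlinarith [hnum]
  have hA : M ^ 2 * I₄ / Rc ≤ M ^ 2 * (U * EU) / Rc :=
    div_le_div_of_nonneg_right (mul_le_mul_of_nonneg_left hI₄ (by positivity)) hRc.le
  have hB : 4 * K * ((γ + 1) * K + 4) / c₁ ^ 2 + 1 / 2 ≤ 100 * K * ((γ + 1) * K + 4) / m ^ 2 + 1 := by linarith
  have hA0 : 0 ≤ M ^ 2 * I₄ / Rc := by positivity
  have hB0 : 0 ≤ 4 * K * ((γ + 1) * K + 4) / c₁ ^ 2 + 1 / 2 := by positivity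
  calc M ^ 2 * I₄ / Rc * (4 * K * ((γ + 1) * K + 4) / c₁ ^ 2 + 1 / 2)
      ≤ M ^ 2 * (U * EU) / Rc * (4 * K * ((γ + 1) * K + 4) / c₁ ^ 2 + 1 / 2) := mul_le_mul_of_nonneg_right hA hB0
    _ ≤ M ^ 2 * (U * EU) / Rc * (100 * K * ((γ + 1) * K + 4) / m ^ 2 + 1) :=
        mul_le_mul_of_nonneg_left hB (div_nonneg (mul_nonneg (sq_nonneg M) (hI₄0.trans hI₄)) hRc.le)
    _ = _ := by ring

/-! ## 3. Extraction of the sup on the whole core from the two dissipation currencies -/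

/-- **Sup of the modulus on `(0, U]` from the currencies `D`, `D₂`.**  `a, b` continuous on `[0,U]`, `a₁, b₁` continuous on `(0,U]`,
`a′ = a₁`, `b′ = b₁` on `(0,U)`, the weighted integrands interval-integrable on `[0,U]`, `m ≠ 0`: for every `u ∈ (0, U]`,
`a(u)² + b(u)² ≤ (3/m²)·∫₀^U e^{γv/4}·m²(a²+b²)/v + (1/4)·∫₀^U e^{γv/4}·4v(a₁²+b₁²)`. -/
theorem core_extraction_le {γ m U : ℝ} {a a₁ b b₁ : ℝ → ℝ} (hγ : 0 < γ) (hm : m ≠ 0) (hU : 0 < U)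
    (ha : ContinuousOn a (Icc 0 U)) (hb : ContinuousOn b (Icc 0 U))
    (ha₁ : ContinuousOn a₁ (Ioc 0 U)) (hb₁ : ContinuousOn b₁ (Ioc 0 U))
    (hdera : ∀ u ∈ Ioo 0 U, HasDerivAt a (a₁ u) u) (hderb : ∀ u ∈ Ioo 0 U, HasDerivAt b (b₁ u) u)
    (hID₁ : IntervalIntegrable (fun u => Real.exp (γ * u / 4) * (4 * u * (a₁ u ^ 2 + b₁ u ^ 2))) volume 0 U)
    (hID₂ : IntervalIntegrable (fun u => Real.exp (γ * u / 4) * (m ^ 2 / u * (a u ^ 2 + b u ^ 2))) volume 0 U) :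
    ∀ u ∈ Ioc 0 U, a u ^ 2 + b u ^ 2
      ≤ 3 / m ^ 2 * (∫ v in (0:ℝ)..U, Real.exp (γ * v / 4) * (m ^ 2 / v * (a v ^ 2 + b v ^ 2)))
        + 1 / 4 * (∫ v in (0:ℝ)..U, Real.exp (γ * v / 4) * (4 * v * (a₁ v ^ 2 + b₁ v ^ 2))) := by
  intro u hu
  have hU0 : 0 ≤ U := hU.le
  have hm2 : 0 < m ^ 2 := by positivity
  -- dyadic interval `[x, 2x] ∋ u` inside `(0, U]`
  set x : ℝ := min u (U / 2) with hxdef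
  have hx0 : 0 < x := lt_min hu.1 (by linarith)
  have hxu : x ≤ u := min_le_left _ _
  have hxU : 2 * x ≤ U := by have := min_le_right u (U / 2); linarith
  have hu2x : u ≤ 2 * x := by
    rcases le_total u (U / 2) with h | h
    · rw [hxdef, min_eq_left h]; linarith
    · rw [hxdef, min_eq_right h]; linarith [hu.2]
  have hx2 : x ≤ 2 * x := by linarith
  have hsubc : Icc x (2 * x) ⊆ Icc 0 U := Icc_subset_Icc hx0.le hxU
  have hsubo : Icc x (2 * x) ⊆ Ioc 0 U := fun v hv => ⟨lt_of_lt_of_le hx0 hv.1, le_trans hv.2 hxU⟩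
  have hsuboo : Ioo x (2 * x) ⊆ Ioo 0 U := fun v hv => ⟨lt_trans hx0 hv.1, lt_of_lt_of_le hv.2 hxU⟩
  have hsubI : uIcc x (2 * x) ⊆ uIcc 0 U := by rw [uIcc_of_le hx2, uIcc_of_le hU0]; exact hsubc
  have hext := sq_le_extraction_of_mem hx0 ⟨hxu, hu2x⟩ (ha.mono hsubc) (hb.mono hsubc) (ha₁.mono hsubo) (hb₁.mono hsubo)
    (fun v hv => hdera v (hsuboo hv)) (fun v hv => hderb v (hsuboo hv))
  have hcont_sv : ContinuousOn (fun v => (a v ^ 2 + b v ^ 2) / v) (Icc x (2 * x)) :=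
    (((ha.mono hsubc).pow 2).add ((hb.mono hsubc).pow 2)).div continuousOn_id
      (fun v hv => (lt_of_lt_of_le hx0 hv.1).ne')
  have hcont_dis : ContinuousOn (fun v => v * (a₁ v ^ 2 + b₁ v ^ 2)) (Icc x (2 * x)) :=
    continuousOn_id.mul (((ha₁.mono hsubo).pow 2).add ((hb₁.mono hsubo).pow 2))
  have h1 : ∫ v in x..(2 * x), (a v ^ 2 + b v ^ 2) / v
      ≤ ∫ v in x..(2 * x), (1 / m ^ 2) * (Real.exp (γ * v / 4) * (m ^ 2 / v * (a v ^ 2 + b v ^ 2))) := by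
    apply integral_mono_on hx2 (hcont_sv.intervalIntegrable_of_Icc hx2) ((hID₂.mono_set hsubI).const_mul _)
    intro v hv
    have hv0 : 0 < v := lt_of_lt_of_le hx0 hv.1
    have hE1 : 1 ≤ Real.exp (γ * v / 4) := Real.one_le_exp (by positivity)
    have hs : 0 ≤ (a v ^ 2 + b v ^ 2) / v := by positivity
    have e : (1 / m ^ 2) * (Real.exp (γ * v / 4) * (m ^ 2 / v * (a v ^ 2 + b v ^ 2)))
        = Real.exp (γ * v / 4) * ((a v ^ 2 + b v ^ 2) / v) := by
      field_simp
    rw [e]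
    nlinarith
  have h2 : ∫ v in x..(2 * x), (1 / m ^ 2) * (Real.exp (γ * v / 4) * (m ^ 2 / v * (a v ^ 2 + b v ^ 2)))
      ≤ (1 / m ^ 2) * ∫ v in (0:ℝ)..U, Real.exp (γ * v / 4) * (m ^ 2 / v * (a v ^ 2 + b v ^ 2)) := by
    rw [intervalIntegral.integral_const_mul]
    apply mul_le_mul_of_nonneg_left _ (by positivity)
    apply integral_mono_interval hx0.le hx2 hxU _ hID₂
    refine MeasureTheory.ae_restrict_of_forall_mem measurableSet_Ioc (fun v hv => ?_)
    have : 0 < v := hv.1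
    positivity
  have h3 : ∫ v in x..(2 * x), v * (a₁ v ^ 2 + b₁ v ^ 2)
      ≤ ∫ v in x..(2 * x), (1 / 4) * (Real.exp (γ * v / 4) * (4 * v * (a₁ v ^ 2 + b₁ v ^ 2))) := by
    apply integral_mono_on hx2 (hcont_dis.intervalIntegrable_of_Icc hx2) ((hID₁.mono_set hsubI).const_mul _)
    intro v hv
    have hv0 : 0 < v := lt_of_lt_of_le hx0 hv.1
    have hE1 : 1 ≤ Real.exp (γ * v / 4) := Real.one_le_exp (by positivity)
    have hs : 0 ≤ v * (a₁ v ^ 2 + b₁ v ^ 2) := by positivity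
    have e : (1 / 4) * (Real.exp (γ * v / 4) * (4 * v * (a₁ v ^ 2 + b₁ v ^ 2)))
        = Real.exp (γ * v / 4) * (v * (a₁ v ^ 2 + b₁ v ^ 2)) := by ring
    rw [e]
    nlinarith
  have h4 : ∫ v in x..(2 * x), (1 / 4) * (Real.exp (γ * v / 4) * (4 * v * (a₁ v ^ 2 + b₁ v ^ 2)))
      ≤ (1 / 4) * ∫ v in (0:ℝ)..U, Real.exp (γ * v / 4) * (4 * v * (a₁ v ^ 2 + b₁ v ^ 2)) := by
    rw [intervalIntegral.integral_const_mul]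
    apply mul_le_mul_of_nonneg_left _ (by norm_num)
    apply integral_mono_interval hx0.le hx2 hxU _ hID₁
    refine MeasureTheory.ae_restrict_of_forall_mem measurableSet_Ioc (fun v hv => ?_)
    have : 0 < v := hv.1
    positivity
  have e3 : 3 / m ^ 2 * (∫ v in (0:ℝ)..U, Real.exp (γ * v / 4) * (m ^ 2 / v * (a v ^ 2 + b v ^ 2)))
      = 3 * ((1 / m ^ 2) * ∫ v in (0:ℝ)..U, Real.exp (γ * v / 4) * (m ^ 2 / v * (a v ^ 2 + b v ^ 2))) := by ring
  rw [e3]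
  linarith [hext, h1, h2, h3, h4]

end Summit.NavierStokesRegularity.NavierStokesRegularity.Theorems.DefectColumnGate

end
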